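import Summits.CriticalPhenomena.SAWScalingLimit.Theses.SAWReversalUpgrade
import Summits.CriticalPhenomena.SAWScalingLimit.Theorems.SAWLoopFugacityFlowAssembly
import HarnessLib

/-!
# `SAWReversalUpgrade.LawEventuallyProbability` (stmt-CriticalPhenomena-18011) — proved

Route `SAWReversalUpgrade` of `CriticalPhenomena/SAWScalingLimit`, support item
`LawEventuallyProbability`: for every Dobrushin domain `D = (Ω; a, b)` and every endpoint
approximation `a_δ, b_δ` (`SAW.IsEndpointApprox`), the critical SAW law
`P_δ ∝ x_c^{|γ|}` on SAWs of `Ω_δ` from `a_δ` to `b_δ` (`SAW.law`) is a probability measure for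
all small `δ > 0`.

Proof (folklore bookkeeping, the argument inlined in the deciding theorem of route
`SAWRenewalTightness`): for small `δ > 0` the endpoints are joined in `Ω_δ`
(`IsEndpointApprox.reachable`), so a SAW exists (the path of a joining walk) and the partition
function `Z_δ = Σ_γ x_c^{|γ|}` is positive (`x_c > 0`); `Ω` is bounded, so there are finitely
many SAWs (`SAW.finite_domainSAW`) and `Z_δ < ∞`; hence `law = Z_δ⁻¹ • weight` has total mass
`1`. This is exactly the landed tree lemma
`SAWLoopFugacityFlowAssembly.eventually_isProbabilityMeasure_law`, reused here (the gate's
dedup forbids restating it).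
-/

namespace Summit.CriticalPhenomena.SAWScalingLimit.Theorems

/-- **`LawEventuallyProbability` holds**: under an endpoint approximation of a Dobrushin domain the
critical SAW law of `(Ω_δ; a_δ, b_δ)` is a probability measure for all small `δ > 0` (joined
endpoints ⇒ a SAW exists ⇒ positive weight; bounded domain ⇒ finitely many SAWs ⇒ finite weight).
[folklore] -/
theorem LawEventuallyProbability_proof :
    Summit.CriticalPhenomena.SAWScalingLimit.Theses.SAWReversalUpgrade.LawEventuallyProbability := by
  unfold Summit.CriticalPhenomena.SAWScalingLimit.Theses.SAWReversalUpgrade.LawEventuallyProbability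
  intro D a b happ
  exact SAWLoopFugacityFlowAssembly.eventually_isProbabilityMeasure_law happ

end Summit.CriticalPhenomena.SAWScalingLimit.Theorems
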